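import Mathlib
import HarnessLib
import Summits.Ventures.LatticeQCDFlow.Exactness.PiGroupKicks

/-!
# Convolution near the identity: laws dominating Haar measure near `1` keep doing so under convolution powers

HONEST FRAMING: exact (Metropolis-corrected) sampling algorithms for lattice gauge theory;
figures of merit are autocorrelation/cost numbers at stated couplings and volumes; no
continuum-physics claim.

Venture `LatticeQCDFlow` (cell pub-lqcd), topic `Exactness`, FANOUT row 9 (eng-latcore; a leaf of the
'update + over-relaxation' composite line — HOME/eng-latcore/lean-sources/gen21/README.md — used by
`MetropolisSweepExactStepErgodic.lean` to show that the Metropolis sweep dominates product Haar on a box around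
every configuration).  NEW WORK of the cell over Mathlib (`Measure.mconv`, `lintegral_mconv`, left invariance
`measure_preimage_mul`, `exists_open_nhds_one_split`) and the tree (`PiGroupKicks.lean`: `mconvPow`).  Nothing is
cited as a fact; no number is claimed.

* `measurable_measure_preimage_mul`, `mconv_apply_eq_lintegral` (`(σ ∗ τ)(E) = ∫ τ((x ·)⁻¹ E) dσ(x)`);
  **`smul_restrict_le_mconv`** — if `σ ≥ a · μ|_A`, `τ ≥ b · μ|_B` and `W ⊆ A` is measurable with `W⁻¹ W ⊆ B`,
  then `σ ∗ τ ≥ (a b μ(W)) · μ|_W` (`μ` left invariant);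
  **`exists_smul_restrict_le_mconvPow`** — on a topological group with `μ` charging open sets, a law dominating
  `a · μ|_V` (`V ∈ 𝓝 1`, `a ≠ 0`) has every convolution power `ν^{∗(t+1)}` dominating `c · μ|_W` for an open
  `W ∋ 1` and `c ≠ 0`.

NOT CLAIMED: any quantitative constant.
-/

noncomputable section

namespace Summit.Ventures.LatticeQCDFlow.Exactness

open MeasureTheory Measure Metric Set Filter Topology Function ProbabilityTheory
open scoped ENNReal Pointwise

/-! ## §1 Convolution near the identity -/

section Conv

variable {G : Type*} [Group G] [MeasurableSpace G] [MeasurableMul₂ G] {μ : Measure G} [μ.IsMulLeftInvariant]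

/-- `x ↦ τ ((x * ·)⁻¹' E)` is measurable for a measurable `E` (sections of `{p : p.1 p.2 ∈ E}`). -/
theorem measurable_measure_preimage_mul (τ : Measure G) [SFinite τ] {E : Set G} (hE : MeasurableSet E) :
    Measurable fun x : G => τ ((fun y => x * y) ⁻¹' E) :=
  measurable_measure_prodMk_left (measurable_mul hE)

/-- The convolution evaluated on a set: `(σ ∗ τ)(E) = ∫ τ((x ·)⁻¹ E) dσ(x)`. -/
theorem mconv_apply_eq_lintegral (σ τ : Measure G) [SFinite σ] [SFinite τ] {E : Set G}
    (hE : MeasurableSet E) : (σ ∗ₘ τ) E = ∫⁻ x, τ ((fun y => x * y) ⁻¹' E) ∂σ := by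
  rw [← lintegral_indicator_one hE, Measure.lintegral_mconv (measurable_one.indicator hE)]
  refine lintegral_congr fun x => ?_
  rw [← lintegral_indicator_one (measurable_const_mul x hE)]
  rfl

/-- **Convolving two laws that dominate `μ` near `1` dominates `μ` near `1`.**  If `σ ≥ a · μ|_A`,
`τ ≥ b · μ|_B`, and `W ⊆ A` is a measurable set with `v⁻¹ w ∈ B` for all `v, w ∈ W`, then
`σ ∗ τ ≥ (a b μ(W)) · μ|_W`: for `E ⊆ W` and `x ∈ W`, `x⁻¹E ⊆ B` and `μ(x⁻¹E) = μ(E)`. -/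
theorem smul_restrict_le_mconv {σ τ : Measure G} [SFinite σ] [SFinite τ] {a b : ℝ≥0∞} {A B W : Set G}
    (hσ : a • μ.restrict A ≤ σ) (hτ : b • μ.restrict B ≤ τ) (hWA : W ⊆ A) (hWm : MeasurableSet W)
    (hWB : ∀ v ∈ W, ∀ w ∈ W, v⁻¹ * w ∈ B) : (a * b * μ W) • μ.restrict W ≤ σ ∗ₘ τ := by
  refine Measure.le_iff.2 fun E hE => ?_
  rw [Measure.smul_apply, Measure.restrict_apply hE, smul_eq_mul, mconv_apply_eq_lintegral σ τ hE]
  have hpre : ∀ x, MeasurableSet ((fun y => x * y) ⁻¹' E) := fun x => measurable_const_mul x hE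
  calc a * b * μ W * μ (E ∩ W) = a * (b * μ (E ∩ W) * μ W) := by ring
    _ = a * ∫⁻ _ in W, b * μ (E ∩ W) ∂μ := by rw [MeasureTheory.setLIntegral_const]
    _ = a * ∫⁻ x in W, b * μ ((fun y => x * y) ⁻¹' (E ∩ W)) ∂μ := by
        congr 1
        exact lintegral_congr fun x => by rw [measure_preimage_mul]
    _ ≤ a * ∫⁻ x in W, b * μ ((fun y => x * y) ⁻¹' E ∩ B) ∂μ := by
        refine mul_le_mul' le_rfl (setLIntegral_mono' hWm fun x hx => mul_le_mul' le_rfl (measure_mono ?_))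
        intro y hy
        refine ⟨hy.1, ?_⟩
        have h := hWB x hx (x * y) hy.2
        rwa [inv_mul_cancel_left] at h
    _ ≤ a * ∫⁻ x in W, τ ((fun y => x * y) ⁻¹' E) ∂μ := by
        refine mul_le_mul' le_rfl (setLIntegral_mono' hWm fun x _ => ?_)
        have h := Measure.le_iff.1 hτ _ (hpre x)
        rwa [Measure.smul_apply, Measure.restrict_apply (hpre x), smul_eq_mul] at h
    _ ≤ a * ∫⁻ x in A, τ ((fun y => x * y) ⁻¹' E) ∂μ :=
        mul_le_mul' le_rfl (lintegral_mono' (Measure.restrict_mono hWA le_rfl) le_rfl)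
    _ = ∫⁻ x, τ ((fun y => x * y) ⁻¹' E) ∂(a • μ.restrict A) := by rw [lintegral_smul_measure, smul_eq_mul]
    _ ≤ ∫⁻ x, τ ((fun y => x * y) ⁻¹' E) ∂σ := lintegral_mono' hσ le_rfl

variable [TopologicalSpace G] [IsTopologicalGroup G] [BorelSpace G] [μ.IsOpenPosMeasure]

/-- **CONVOLUTION POWERS OF A LAW DOMINATING `μ` NEAR `1` DOMINATE `μ` NEAR `1`.**  If
`ν ≥ a · μ|_V` with `V ∈ 𝓝 1` and `a ≠ 0`, then for every `t` there are an open `W ∋ 1` and `c ≠ 0`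
with `c · μ|_W ≤ ν^{∗(t+1)}`. -/
theorem exists_smul_restrict_le_mconvPow {ν : Measure G} [SFinite ν] {a : ℝ≥0∞} (ha : a ≠ 0) {V : Set G}
    (hV : V ∈ 𝓝 (1 : G)) (hν : a • μ.restrict V ≤ ν) :
    ∀ t : ℕ, ∃ W : Set G, IsOpen W ∧ (1 : G) ∈ W ∧ ∃ c : ℝ≥0∞, c ≠ 0 ∧ c • μ.restrict W ≤ mconvPow ν (t + 1)
  | 0 => by
      refine ⟨interior V, isOpen_interior, mem_interior_iff_mem_nhds.2 hV, a, ha, ?_⟩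
      rw [zero_add, mconvPow_succ, mconvPow_zero, Measure.mconv_dirac_one]
      calc a • μ.restrict (interior V) ≤ a • μ.restrict V := by
            refine Measure.le_iff'.2 fun E => ?_
            simp only [Measure.smul_apply, smul_eq_mul]
            exact mul_le_mul' le_rfl (Measure.le_iff'.1 (Measure.restrict_mono interior_subset le_rfl) E)
        _ ≤ ν := hν
  | t + 1 => by
      obtain ⟨W, hWo, hW1, c, hc, hle⟩ := exists_smul_restrict_le_mconvPow ha hV hν t
      obtain ⟨V₀, hV₀o, hV₀1, hV₀⟩ := exists_open_nhds_one_split (hWo.mem_nhds hW1)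
      set W' : Set G := interior V ∩ (V₀ ∩ V₀⁻¹) with hW'
      have hW'o : IsOpen W' := isOpen_interior.inter (hV₀o.inter hV₀o.inv)
      have hW'1 : (1 : G) ∈ W' := ⟨mem_interior_iff_mem_nhds.2 hV, hV₀1, by rw [Set.mem_inv, inv_one]; exact hV₀1⟩
      refine ⟨W', hW'o, hW'1, a * c * μ W', mul_ne_zero (mul_ne_zero ha hc) (hW'o.measure_ne_zero μ ⟨1, hW'1⟩), ?_⟩
      rw [mconvPow_succ]
      refine smul_restrict_le_mconv hν hle (inter_subset_left.trans interior_subset) hW'o.measurableSet ?_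
      intro v hv w hw
      exact hV₀ v⁻¹ (Set.mem_inv.1 hv.2.2) w hw.2.1

end Conv

end Summit.Ventures.LatticeQCDFlow.Exactness
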